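import Mathlib
import Summits.PneNP.PneNP.Theorems.ClusUniversalCertificateCoordDefs

/-!
# Route ClusUniversalCertificate, crux `UniversalCertAll` — path `coord`: registered stub `stub_cBook`

Stub file for `stmt-PneNP-19683` (cell pnp-ideate, route `ClusUniversalCertificate`, rung F-N1; path `coord` of
pnp-ideate-p1, skeletons v6 sha16 ed80fa78 / v7 sha16 d87d5ac2, objects of record `Theorems/ClusUniversalCertificateCoordDefs.lean`
p516754, namespace `…Theorems.ClusCoord`): **`stub_cBook`** — the COORDINATE BOOKKEEPING step of the coordinate-peeling
induction with mixed block sizes.  Deleting coordinate `i` (of block `k = blk i`) maps `𝔽₂^{M+1} → 𝔽₂^M` with block map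
`blk ∘ i.succAbove`; a coordinate layer family `L` of `(Y, i)` covers each fibre with its multiplicity.  Pure bookkeeping:

* GENERIC DOUBLE COUNTING (`list_sum_card_filter_eq`): if every point `x` lies in as many members of `L` as `Y` has points
  over `x`, then `Σ_{S∈L} #{x ∈ S : P x} = #{y ∈ Y : P (π y)}` for every property `P`;
* `Σ_{S∈L} |S| = |Y|`; for a block `j ≠ k`: `Σ_S Z_j(S) = Z_j(Y)`; for the block `k` of the deleted coordinate:
  `Σ_S Z_k(S) = Z_k(Y) + W_i(Y)` (a point one coordinate down has block `k` zero iff the point of `Y` above it has block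
  `k` equal to `0` or to `e_i`);
* `bsize (blk ∘ i.succAbove) j = bsize blk j − [j = k]`, so the members' dimension offsets sum to one less than `Y`'s and
  `2^{bsize k} = 2 · 2^{bsize k − 1}`;
* hence the members' mixed certificates plus the coordinate layer inequality
  `D(Y) ≤ Σ_S D(S) + |Y| + 2^{bsize k − 1}(Z_k(Y) − W_i(Y))` give the mixed certificate of `Y`.

FRONTIER rung F-N1 (a combinatorial certificate about affine flats in `𝔽₂^M`); the path's conjecture (`stub_cllZeroRare` /
`stub_peelZeroRare`) and the crux are OPEN; nothing here bears on P vs NP.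
-/

set_option linter.dupNamespace false -- `Summit.PneNP.PneNP.…`: summit = sub-problem name (D-0017 single-conjunct layout)

namespace Summit.PneNP.PneNP.Theorems.ClusCoordBook

open Finset
open Summit.PneNP.PneNP.Theorems.ClusCoord (acodim dsum bsize zcount wcount UCMix IsCLayerFamily CLayerIneq)

/-! ## List-sum plumbing (in `ℤ`) -/

/-- A list sum of finite sums is the finite sum of the list sums. -/
theorem list_sum_map_finset_sum {α β : Type*} (L : List α) (U : Finset β) (g : α → β → ℤ) :
    (L.map fun S => ∑ x ∈ U, g S x).sum = ∑ x ∈ U, (L.map fun S => g S x).sum := by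
  induction L with
  | nil => simp
  | cons S L ih => simp only [List.map_cons, List.sum_cons, Finset.sum_add_distrib, ih]

/-- Counting the members of a list containing a point, as a list sum of indicators. -/
theorem list_sum_indicator {β : Type*} (L : List (Finset β)) (x : β) [DecidableEq β] :
    (L.map fun S => if x ∈ S then (1 : ℤ) else 0).sum = ((L.filter fun S => x ∈ S).length : ℤ) := by
  induction L with
  | nil => simp
  | cons S L ih =>
    rw [List.map_cons, List.sum_cons, ih]
    by_cases h : x ∈ S
    · simp [h, add_comm]
    · simp [h]

/-- Pointwise comparison of list sums. -/
theorem list_sum_map_le {α : Type*} (L : List α) (f g : α → ℤ) (h : ∀ S ∈ L, f S ≤ g S) :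
    (L.map f).sum ≤ (L.map g).sum := by
  induction L with
  | nil => simp
  | cons S L ih =>
    simp only [List.map_cons, List.sum_cons]
    exact add_le_add (h S (by simp)) (ih fun T hT => h T (by simp [hT]))

/-- List sums of differences. -/
theorem list_sum_map_sub {α : Type*} (L : List α) (f g : α → ℤ) :
    (L.map fun S => f S - g S).sum = (L.map f).sum - (L.map g).sum := by
  induction L with
  | nil => simp
  | cons S L ih => simp only [List.map_cons, List.sum_cons, ih]; ring

/-- List sums of scalar multiples. -/
theorem list_sum_map_mul {α : Type*} (L : List α) (c : ℤ) (f : α → ℤ) :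
    (L.map fun S => c * f S).sum = c * (L.map f).sum := by
  induction L with
  | nil => simp
  | cons S L ih => simp only [List.map_cons, List.sum_cons, ih]; ring

/-! ## Generic double counting through a family with prescribed multiplicities -/

/-- **Double counting.** If every point `x` of `β` lies in exactly as many members of `L` as `Y` has points over `x`
(along `π`), then for every property `P`: `Σ_{S ∈ L} #{x ∈ S : P x} = #{y ∈ Y : P (π y)}`. -/
theorem list_sum_card_filter_eq {α β : Type*} [Fintype β] [DecidableEq β] (π : α → β) (Y : Finset α)
    (L : List (Finset β)) (hL : ∀ x : β, (L.filter fun S => x ∈ S).length = (Y.filter fun y => π y = x).card)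
    (P : β → Prop) [DecidablePred P] :
    (L.map fun S => ((S.filter P).card : ℤ)).sum = ((Y.filter fun y => P (π y)).card : ℤ) := by
  have hS : ∀ S : Finset β, ((S.filter P).card : ℤ) = ∑ x ∈ univ.filter P, (if x ∈ S then (1 : ℤ) else 0) := by
    intro S
    rw [Finset.sum_ite_mem, Finset.card_eq_sum_ones, Nat.cast_sum]
    simp only [Nat.cast_one]
    congr 1
    ext x
    simp [and_comm]
  have hL' : ∀ x : β, ((L.filter fun S => x ∈ S).length : ℤ) = ((Y.filter fun y => π y = x).card : ℤ) :=
    fun x => by rw [hL x]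
  simp_rw [hS]
  rw [list_sum_map_finset_sum]
  simp_rw [list_sum_indicator, hL']
  rw [Finset.card_eq_sum_card_fiberwise (f := π) (s := Y.filter fun y => P (π y)) (t := univ.filter P)
    (fun y hy => Finset.mem_filter.2 ⟨Finset.mem_univ _, (Finset.mem_filter.1 hy).2⟩)]
  push_cast
  refine Finset.sum_congr rfl fun x hx => ?_
  have hPx : P x := (Finset.mem_filter.1 hx).2
  congr 2
  ext y
  simp only [Finset.mem_filter]
  constructor
  · rintro ⟨hy, hyx⟩; exact ⟨⟨hy, hyx ▸ hPx⟩, hyx⟩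
  · rintro ⟨⟨hy, -⟩, hyx⟩; exact ⟨hy, hyx⟩

/-! ## The counting identities of the coordinate step -/

variable {M n : ℕ}

/-- `Σ_{S ∈ L} |S| = |Y|` for a coordinate layer family. -/
theorem sum_card (Y : Finset (Fin (M + 1) → ZMod 2)) (i : Fin (M + 1)) (L : List (Finset (Fin M → ZMod 2)))
    (hL : IsCLayerFamily Y i L) : (L.map fun S => (S.card : ℤ)).sum = (Y.card : ℤ) := by
  have h := list_sum_card_filter_eq (fun y => Fin.removeNth i y) Y L hL (fun _ => True)
  simp only [Finset.filter_true_of_mem (fun _ _ => trivial)] at h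
  exact h

/-- Block `j ≠ blk i` one coordinate down: the zero pattern is unchanged. -/
theorem blockZero_removeNth_iff_of_ne (blk : Fin (M + 1) → Fin n) (i : Fin (M + 1)) (j : Fin n) (hj : blk i ≠ j)
    (y : Fin (M + 1) → ZMod 2) :
    (∀ l : Fin M, (blk ∘ Fin.succAbove i) l = j → Fin.removeNth i y l = 0) ↔ (∀ i', blk i' = j → y i' = 0) := by
  rw [Fin.forall_iff_succAbove (p := i)]
  simp only [Function.comp_apply, Fin.removeNth]
  constructor
  · intro h; exact ⟨fun h' => absurd h' hj, h⟩
  · intro h; exact h.2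

/-- Block `k = blk i` one coordinate down: block `k` of the projected point vanishes iff block `k` of `y` is `0` or `e_i`. -/
theorem blockZero_removeNth_iff_self (blk : Fin (M + 1) → Fin n) (i : Fin (M + 1)) (y : Fin (M + 1) → ZMod 2) :
    (∀ l : Fin M, (blk ∘ Fin.succAbove i) l = blk i → Fin.removeNth i y l = 0) ↔
      ((∀ i', blk i' = blk i → y i' = 0) ∨ (y i = 1 ∧ ∀ i', blk i' = blk i → i' ≠ i → y i' = 0)) := by
  have key : (∀ l : Fin M, (blk ∘ Fin.succAbove i) l = blk i → Fin.removeNth i y l = 0) ↔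
      (∀ i', blk i' = blk i → i' ≠ i → y i' = 0) := by
    rw [Fin.forall_iff_succAbove (p := i)]
    simp only [Function.comp_apply, Fin.removeNth, ne_eq, not_true_eq_false, IsEmpty.forall_iff, implies_true,
      true_and]
    constructor
    · intro h l hl _; exact h l hl
    · intro h l hl; exact h l hl (Fin.succAbove_ne i l)
  rw [key]
  constructor
  · intro h
    have h01 : ∀ a : ZMod 2, a = 0 ∨ a = 1 := by decide
    rcases h01 (y i) with h0 | h1
    · left
      intro i' hi'
      by_cases hii : i' = i
      · rw [hii]; exact h0
      · exact h i' hi' hii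
    · right; exact ⟨h1, h⟩
  · rintro (h | ⟨-, h⟩)
    · intro i' hi' _; exact h i' hi'
    · exact h

/-- `Σ_{S ∈ L} Z_j(S) = Z_j(Y)` for a block `j` other than the block of the deleted coordinate. -/
theorem sum_zcount_of_ne (blk : Fin (M + 1) → Fin n) (Y : Finset (Fin (M + 1) → ZMod 2)) (i : Fin (M + 1))
    (L : List (Finset (Fin M → ZMod 2))) (hL : IsCLayerFamily Y i L) (j : Fin n) (hj : blk i ≠ j) :
    (L.map fun S => (zcount (blk ∘ Fin.succAbove i) j S : ℤ)).sum = (zcount blk j Y : ℤ) := by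
  unfold zcount
  rw [list_sum_card_filter_eq (fun y => Fin.removeNth i y) Y L hL]
  congr 2
  exact Finset.filter_congr fun y _ => blockZero_removeNth_iff_of_ne blk i j hj y

/-- `Σ_{S ∈ L} Z_k(S) = Z_k(Y) + W_i(Y)` for the block `k = blk i` of the deleted coordinate. -/
theorem sum_zcount_self (blk : Fin (M + 1) → Fin n) (Y : Finset (Fin (M + 1) → ZMod 2)) (i : Fin (M + 1))
    (L : List (Finset (Fin M → ZMod 2))) (hL : IsCLayerFamily Y i L) :
    (L.map fun S => (zcount (blk ∘ Fin.succAbove i) (blk i) S : ℤ)).sum =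
      (zcount blk (blk i) Y : ℤ) + (wcount blk i Y : ℤ) := by
  unfold zcount wcount
  rw [list_sum_card_filter_eq (fun y => Fin.removeNth i y) Y L hL]
  rw [Finset.filter_congr fun y (_ : y ∈ Y) => blockZero_removeNth_iff_self blk i y, Finset.filter_or]
  rw [← Nat.cast_add, Finset.card_union_of_disjoint]
  apply Finset.disjoint_filter.2
  intro y _ h0 h1
  have := h0 i rfl
  rw [h1.1] at this
  exact one_ne_zero this

/-- All blocks at once: `Σ_{S ∈ L} Z_j(S) = Z_j(Y) + [j = blk i]·W_i(Y)`. -/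
theorem sum_zcount (blk : Fin (M + 1) → Fin n) (Y : Finset (Fin (M + 1) → ZMod 2)) (i : Fin (M + 1))
    (L : List (Finset (Fin M → ZMod 2))) (hL : IsCLayerFamily Y i L) (j : Fin n) :
    (L.map fun S => (zcount (blk ∘ Fin.succAbove i) j S : ℤ)).sum =
      (zcount blk j Y : ℤ) + (if blk i = j then (wcount blk i Y : ℤ) else 0) := by
  by_cases hj : blk i = j
  · subst hj
    rw [if_pos rfl]
    exact sum_zcount_self blk Y i L hL
  · rw [if_neg hj, add_zero]
    exact sum_zcount_of_ne blk Y i L hL j hj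

/-- Block sizes one coordinate down: `bsize blk j = bsize (blk ∘ i.succAbove) j + [blk i = j]`. -/
theorem bsize_eq_succAbove (blk : Fin (M + 1) → Fin n) (i : Fin (M + 1)) (j : Fin n) :
    bsize blk j = bsize (blk ∘ Fin.succAbove i) j + (if blk i = j then 1 else 0) := by
  unfold bsize
  rw [Finset.card_filter, Finset.card_filter, Fin.sum_univ_succAbove _ i]
  simp only [Function.comp_apply]
  ring

/-- In particular `bsize blk (blk i) - 1 = bsize (blk ∘ i.succAbove) (blk i)`. -/
theorem bsize_self_sub_one (blk : Fin (M + 1) → Fin n) (i : Fin (M + 1)) :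
    bsize blk (blk i) - 1 = bsize (blk ∘ Fin.succAbove i) (blk i) := by
  rw [bsize_eq_succAbove blk i (blk i), if_pos rfl]
  simp

/-- The weights one coordinate down: `2^{bsize blk j} = 2^{bsize' j} + [blk i = j]·2^{bsize' j}`. -/
theorem pow_bsize_eq (blk : Fin (M + 1) → Fin n) (i : Fin (M + 1)) (j : Fin n) :
    (2 : ℤ) ^ (bsize blk j) = (2 : ℤ) ^ (bsize (blk ∘ Fin.succAbove i) j) +
      (if blk i = j then (2 : ℤ) ^ (bsize (blk ∘ Fin.succAbove i) j) else 0) := by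
  rw [bsize_eq_succAbove blk i j]
  by_cases hj : blk i = j
  · rw [if_pos hj, if_pos hj, pow_succ]; ring
  · rw [if_neg hj, if_neg hj]; simp

/-- The dimension offsets: `Σ_j (bsize blk j − 1) = Σ_j (bsize' j − 1) + 1`. -/
theorem sum_bsize_sub_one (blk : Fin (M + 1) → Fin n) (i : Fin (M + 1)) :
    ∑ j : Fin n, ((bsize blk j : ℤ) - 1) = ∑ j : Fin n, ((bsize (blk ∘ Fin.succAbove i) j : ℤ) - 1) + 1 := by
  have h : ∀ j : Fin n, ((bsize blk j : ℤ) - 1) =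
      ((bsize (blk ∘ Fin.succAbove i) j : ℤ) - 1) + (if blk i = j then (1 : ℤ) else 0) := by
    intro j
    rw [bsize_eq_succAbove blk i j]
    push_cast
    ring
  simp_rw [h]
  rw [Finset.sum_add_distrib, Finset.sum_ite_eq]
  simp

end Summit.PneNP.PneNP.Theorems.ClusCoordBook

namespace Summit.PneNP.PneNP.Theorems.ClusCoord

open Finset
open Summit.PneNP.PneNP.Theorems.ClusCoordBook

/-- **Registered stub `stub_cBook` of path `coord`** (stmt-PneNP-19683): a coordinate layer family with the coordinate layer
inequality transfers the members' mixed certificates (block map `blk ∘ i.succAbove`: block `blk i` shrinks by one) to `Y`.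
Pure bookkeeping: `Σ_S |S| = |Y|`, `Σ_S Z_j(S) = Z_j(Y) + [j = blk i]·W_i(Y)`, `bsize' j = bsize j − [j = blk i]`,
`2^{bsize (blk i)} = 2·2^{bsize (blk i) − 1}`, then `linarith`. -/
theorem stub_cBook : ∀ M n : ℕ, ∀ blk : Fin (M + 1) → Fin n, ∀ Y : Finset (Fin (M + 1) → ZMod 2), ∀ i : Fin (M + 1),
    ∀ L : List (Finset (Fin M → ZMod 2)), IsCLayerFamily Y i L → CLayerIneq M n blk Y i L →
      (∀ S ∈ L, UCMix M n (blk ∘ Fin.succAbove i) S) → UCMix (M + 1) n blk Y := by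
  intro M n blk Y i L hfam hineq hmem
  -- abbreviations: the offsets `B'` (members) and the weights `w' j` one coordinate down
  set blk' : Fin M → Fin n := blk ∘ Fin.succAbove i with hblk'
  set B' : ℤ := ∑ j : Fin n, ((bsize blk' j : ℤ) - 1) with hB'
  -- the members' certificates: `dsum M S − B'|S| ≤ Σ_j 2^{bsize' j} Z_j(S)`
  have hmem' : ∀ S ∈ L, dsum M S - B' * (S.card : ℤ) ≤
      ∑ j : Fin n, (2 : ℤ) ^ (bsize blk' j) * (zcount blk' j S : ℤ) := by
    intro S hS
    have h := hmem S hS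
    unfold UCMix at h
    unfold dsum
    rw [Finset.sum_sub_distrib, Finset.sum_const, nsmul_eq_mul] at h
    linarith
  -- summed over the family
  have hsum : (L.map (dsum M)).sum - B' * (Y.card : ℤ) ≤
      ∑ j : Fin n, (2 : ℤ) ^ (bsize blk' j) * ((zcount blk j Y : ℤ) + (if blk i = j then (wcount blk i Y : ℤ) else 0)) := by
    have h1 := list_sum_map_le L _ _ hmem'
    rw [list_sum_map_sub, list_sum_map_mul, sum_card Y i L hfam, list_sum_map_finset_sum] at h1
    refine h1.trans (le_of_eq (Finset.sum_congr rfl fun j _ => ?_))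
    rw [list_sum_map_mul, sum_zcount blk Y i L hfam j]
  -- the coordinate layer inequality
  unfold CLayerIneq at hineq
  rw [bsize_self_sub_one blk i] at hineq
  -- the goal, rewritten with `dsum` and the offsets `B = B' + 1`
  unfold UCMix
  rw [Finset.sum_sub_distrib, Finset.sum_const, nsmul_eq_mul, sum_bsize_sub_one blk i]
  change dsum (M + 1) Y - _ ≤ _
  -- the right-hand side: `Σ_j 2^{bsize j} Z_j(Y) = Σ_j 2^{bsize' j} Z_j(Y) + 2^{bsize' (blk i)} Z_{blk i}(Y)`
  have hrhs : ∑ j : Fin n, (2 : ℤ) ^ (bsize blk j) * (zcount blk j Y : ℤ) =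
      ∑ j : Fin n, (2 : ℤ) ^ (bsize blk' j) * (zcount blk j Y : ℤ) +
        (2 : ℤ) ^ (bsize blk' (blk i)) * (zcount blk (blk i) Y : ℤ) := by
    have h : ∀ j : Fin n, (2 : ℤ) ^ (bsize blk j) * (zcount blk j Y : ℤ) =
        (2 : ℤ) ^ (bsize blk' j) * (zcount blk j Y : ℤ) +
          (if blk i = j then (2 : ℤ) ^ (bsize blk' j) * (zcount blk j Y : ℤ) else 0) := by
      intro j
      rw [pow_bsize_eq blk i j]
      by_cases hj : blk i = j
      · rw [if_pos hj, if_pos hj]; ring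
      · rw [if_neg hj, if_neg hj]; ring
    simp_rw [h]
    rw [Finset.sum_add_distrib, Finset.sum_ite_eq]
    simp
  -- the summed members' right-hand side, split the same way
  have hsplit : ∑ j : Fin n, (2 : ℤ) ^ (bsize blk' j) * ((zcount blk j Y : ℤ) + (if blk i = j then (wcount blk i Y : ℤ) else 0)) =
      ∑ j : Fin n, (2 : ℤ) ^ (bsize blk' j) * (zcount blk j Y : ℤ) +
        (2 : ℤ) ^ (bsize blk' (blk i)) * (wcount blk i Y : ℤ) := by
    have h : ∀ j : Fin n, (2 : ℤ) ^ (bsize blk' j) * ((zcount blk j Y : ℤ) + (if blk i = j then (wcount blk i Y : ℤ) else 0)) =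
        (2 : ℤ) ^ (bsize blk' j) * (zcount blk j Y : ℤ) +
          (if blk i = j then (2 : ℤ) ^ (bsize blk' j) * (wcount blk i Y : ℤ) else 0) := by
      intro j
      by_cases hj : blk i = j
      · rw [if_pos hj, if_pos hj]; ring
      · rw [if_neg hj, if_neg hj]; ring
    simp_rw [h]
    rw [Finset.sum_add_distrib, Finset.sum_ite_eq]
    simp
  rw [hsplit] at hsum
  rw [hrhs]
  linarith

end Summit.PneNP.PneNP.Theorems.ClusCoord
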